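import Literature.MathematicalPhysics.QuantumFieldTheory.Balaban1983to89.T4StairWordSystemCubeTree

/-!
# `Balaban1983to89.T4StairWordSystemCubeTreeGlue` — THE TREE-OF-BOXES WORD SYSTEM, II: THE GLUING STEP «parent box ∪ child box attached through an entry site», output in the
# input's shape (so it iterates along a tree of boxes), in the ONE-BOND-BOUND currency of `T4WordSystemGaugeBound.exists_gauge_one_on_nearFlat_of_bondBound`

Cell `pub-ymgap` (Track A DAG, node N12 = [B15] = T. Bałaban, *Large field renormalization. I*, Commun. Math. Phys. **122** (1989) 175–202
[Balaban1989LargeFieldI]), width seat `dag-n12-w2` (g5), piece (R1) §3 (lane word dag-n12-c g19, cell bus l.37564: *«state the two-box lemma so that its OUTPUT is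
again a word system … then box ∪ (tree of boxes) glued along a face iterates by the same lemma»*; LOCATED-GEOM v3 (3), l.38396).  Count-neutral Literature helper.
HONEST FRAMING: lattice ∕ gauge bookkeeping on the tree's own objects ([Balaban1987RG1] (0.3) staircase words, [Balaban1985Averaging] (8), (19)–(20)) assembled from
`T4StairWordSystemCubeTree` §1–§2 BY NAME; nothing of Bałaban's estimates ((1.7) ∕ (2.14) plaquette smallness, [15] Thm 1, Proposition 1, the datum side) is asserted;
N12 is NOT discharged by this file; one finite `𝕋⁴` programme at fixed `ε`; nothing here bears on the continuum ∕ OS ∕ mass-gap statement.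

THE SETTING (all hypotheses displayed; see the first file's header for why the one-bond-bound currency).  A configuration `U` with `PlaqSmallOn S δ U`; a rooted word system
`(r, X, w)` whose words end at their sites and satisfy (INV) `dist1 (𝒰_U(walk r (w s))·U(s,ν)·𝒰_U(walk r (w (s+e_ν)))⁻¹) ≤ K·δ` on the bonds of `X`; a PARENT BOX
`Q = castSite '' [A, B] ⊆ X` (at most `m+1` sites per direction) with its own constant `K_Q` on `Q`'s bonds — for a box glued earlier this is `boxWords_bondBound`'s `K_box(m)`,
NOT the running `K`; a CHILD BOX `Q′ = castSite '' [A′, B′]` (at most `m′+1` sites per direction, box coordinates `rep′`), jointly non-wrapping with `Q`, SEPARATED from `Q` in the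
gluing axis `μ` (`B_μ < A′_μ ∨ B′_μ < A_μ`) and touching `X` only through `Q`; an ENTRY `f̃ ∈ [A, B] ∩ [A′ − 1, B′ + 1]`; the glued words `W = w` on `X` and
`W x = w(castSite f̃) ++ stairWord σ′ (rep′ x − f̃)` on `Q′`, the gluing axis `μ` FIRST in `σ′`.

WHAT IS PROVED (no `def`, no `sorry`; `G` any `GaugeGroup`):
* §3 ★★★ `treeGlue_crossBond_bondBound` — every bond between `Q` and `Q′` (either orientation; axis FORCED to be `μ`, parent end in the entry layer `f̃_μ`) satisfies (INV) with
  `K_cross = d·M̄·K_Q + (2dM̄+1)²∕4`, `M̄ = max m m′ + 1`, as soon as the CROSS BOX of plaquettes — `[f̃_μ − 1, f̃_μ + 3]` in `μ`, `[min(A, 2f̃−B), max(B, 2f̃−A) + 2]` in the other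
  axes (zero overshoot beyond `Q ∪ Q′` for aligned equal cubes, up to the currency's plaquette reach) — lies in `S`; ★★★ `treeGlue_union_bondBound` — THE GLUING STEP: (i) glued
  words end at their sites; (ii) `|W x| ≤ |w(castSite f̃)| + d·(m′+1)` on `Q′`; (iii) (INV) on `Q′`'s own bonds with `K_box(m′) = (2(d(m′+1)+1)+1)²∕4` (the constant `Q′` hands to
  ITS children); (iv) (INV) on all bonds of `X ∪ Q′` with `max K (max K_box(m′) K_cross)` — the same at every depth of a tree of boxes of bounded size.
* §4 ★★ `exists_gauge_one_on_nearFlat_of_bondBoundSystem` ((INV) + a set `B` whose words stay inside it ⇒ the normaliser `u = 1` on `B`, `dist1 (W^u b) ≤ C + ℓε₁ + ε₁` on `X`'s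
  bonds); ★★★ `exists_gauge_normalising_extend_of_bondBoundSystem_le` — the edition at the objects of [15] Proposition 1 IN THE SHAPE OF THE LETTER `hgauge`
  (`T4WordSystemGaugeBound.exists_gauge_normalising_extend_of_words_hub_le` with the hub letter `hcount` REPLACED by (INV) for every configuration with small plaquettes on `Z^{(k)}`).
HONEST SCOPE (LOCATED-GEOM v2 ∕ v3 unchanged): trees of parallelepipeds glued along faces, each new box touching the current union only through its parent box; ring-shaped
`Ω₁(Z)` stay vacuous-by-shape (dag-n12-c's `B15Prop1HolonomyObstruction`); `⊆ Z^{(k)}` of the two located boxes is the knit's collar inclusion, not proved here.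

References: T. Bałaban, CMP 122 (1989) 175–202 [Balaban1989LargeFieldI] (p.194); CMP 98 (1985) 17–51 [Balaban1985Averaging] ((8)–(9) p.19, (19)–(20) p.21);
CMP 109 (1987) 249–301 [Balaban1987RG1] ((0.3) p.252); CMP 102 (1985) 277–309 [Balaban1985Variational] ((16)–(18) p.280).
-/

noncomputable section

open Set

namespace Literature.MathematicalPhysics.QuantumFieldTheory.Balaban1983to89.T4StairWordSystemCubeTreeGlue

open T4Continuum T4ReflectionCone
open T4AxialGaugeSmallField (castSite castSite_apply castSite_add_e boxPlaqs castSite_injOn_box)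
open B7Prop1Explicit (e e_apply)
open LatticeWordCountBox (walkEnd_castSite plaq_countBox_lt_of_plaqSmallOn_boxPlaqs)
open T4StairWordPrefix (boxPlaqs_mono length_stairRuns_le)
open T4WordSystemGaugeBound (dist1_holAt_le_length_mul length_walk' exists_gauge_one_on_nearFlat_of_bondBound)
open B15DeterminingSets
open B15Prop1Carrier (plaqsInside)
open B15Extension193 (extend cutoff cutoff_of_mem cutoff_of_not_mem)
open B15ShellGauge193 (shellGauge)
open B15ShellGauge193Local (dist1_plaqHol_extend_shellGauge_le)
open B15Prop1DatumGaugeNormalisation (dist1_primed_shellGauge_le_bigBox gaugeAct_mul_eq shellGauge_corner_eq_one)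
open T4ReTrLipUnitary (plaqSmallOn_gaugeAct_iff)
open T4StairWordSystemCubeTree (boxWords_bondBound walk_stairWord_mem_box count_crossLoop_le crossBond_forced crossBond_forced'
  dist1_crossBond_le_of_entry dist1_crossBond_le_of_entry')

variable {P : Params} {j : ℕ}

/-! ## §3 ★★★ THE GLUING STEP: a child box attached to a parent box through an entry site -/

section Glue

variable {G : Type*} [GaugeGroup G]

/-- ★★★ **THE CROSS BONDS OF THE GLUING STEP.**  Parent box `Q = castSite '' [A, B]` (at most `m + 1` sites per direction) whose words `w x` end at their sites and satisfy
(INV) on `Q`'s own bonds with constant `K_Q`; child box `Q′ = castSite '' [A′, B′]` (at most `m′ + 1` sites per direction, box coordinates `rep′`), the pair jointly non-wrapping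
and SEPARATED in the gluing axis `μ`; entry `f̃ ∈ [A, B] ∩ [A′ − 1, B′ + 1]`; child words `w′ x = w(castSite f̃) ++ stairWord σ′ (rep′ x − f̃)`.  If the CROSS BOX of plaquettes —
`[f̃_μ − 1, f̃_μ + 3]` in the axis `μ`, `[min(A, 2f̃ − B), max(B, 2f̃ − A) + 2]` in the other axes (the parent box's transverse extent mirrored about `f̃`; zero overshoot beyond
`Q ∪ Q′` for aligned equal cubes, up to the currency's plaquette reach) — lies in `S`, then every bond between `Q` and `Q′` (either orientation; its axis is FORCED to be `μ` and its
parent end to lie in the entry layer `f̃_μ`) satisfies (INV) with `K_cross = d·M̄·K_Q + (2dM̄ + 1)²∕4`, `M̄ = max m m′ + 1` (§2's chain through `castSite f̃`: `|z|, |sw| ≤ d·M̄`).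
[cite: Balaban1989LargeFieldI, p.194 (sentence after (1.77)); Balaban1985Averaging, (8)-(9) p.19 and (19)-(20) p.21] -/
theorem treeGlue_crossBond_bondBound (U : GaugeField P j G) {S : Set (Plaq P j)} {δ : ℝ} (hδ : 0 ≤ δ) (hU : PlaqSmallOn S δ U)
    (r : Site P j) (w : Site P j → List (Letter P.d))
    {A B : Fin P.d → ℤ} {m : ℕ} (hm : ∀ κ, B κ ≤ A κ + m)
    (hQend : ∀ x ∈ (castSite '' Set.Icc A B : Set (Site P j)), walkEnd r (w x) = x)
    {KQ : ℝ} (hKQ : 0 ≤ KQ)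
    (hQ : ∀ (s : Site P j) (ν : Fin P.d), s ∈ (castSite '' Set.Icc A B : Set (Site P j)) → s.shift ν ∈ (castSite '' Set.Icc A B : Set (Site P j)) →
      dist1 (holAt U (walk r (w s)) * U ⟨s, ν⟩ * (holAt U (walk r (w (s.shift ν))))⁻¹) ≤ KQ * δ)
    {A' B' : Fin P.d → ℤ} {m' : ℕ} (hm' : ∀ κ, B' κ ≤ A' κ + m') (rep' : Site P j → Fin P.d → ℤ)
    (hrep' : ∀ x ∈ (castSite '' Set.Icc A' B' : Set (Site P j)), A' ≤ rep' x ∧ rep' x ≤ B' ∧ (castSite (rep' x) : Site P j) = x)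
    (hN : ∀ κ, max (B κ) (B' κ) + 1 - min (A κ) (A' κ) < (P.sitesPerDir j : ℤ))
    (μ : Fin P.d) (hsep : B μ < A' μ ∨ B' μ < A μ) {f : Fin P.d → ℤ} (hfA : A ≤ f) (hfB : f ≤ B) (hfA' : A' - 1 ≤ f) (hfB' : f ≤ B' + 1)
    (σ' : Equiv.Perm (Fin P.d)) (w' : Site P j → List (Letter P.d))
    (hw' : ∀ x ∈ (castSite '' Set.Icc A' B' : Set (Site P j)), w' x = w (castSite f) ++ stairWord σ' (rep' x - f))
    (hMN : 2 * (P.d * (max m m' + 1)) + 1 < P.sitesPerDir j)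
    (hS : (boxPlaqs (fun κ => if κ = μ then f μ - 1 else min (A κ) (2 * f κ - B κ))
              (fun κ => if κ = μ then f μ + 3 else max (B κ) (2 * f κ - A κ) + 2) : Set (Plaq P j)) ⊆ S) :
    (∀ (s : Site P j) (ν : Fin P.d), s ∈ (castSite '' Set.Icc A B : Set (Site P j)) → s.shift ν ∈ (castSite '' Set.Icc A' B' : Set (Site P j)) →
      dist1 (holAt U (walk r (w s)) * U ⟨s, ν⟩ * (holAt U (walk r (w' (s.shift ν))))⁻¹)
        ≤ (((P.d * (max m m' + 1) : ℕ) : ℝ) * KQ + ((2 * (P.d * (max m m' + 1)) + 1 : ℕ) : ℝ) ^ 2 / 4) * δ) ∧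
    (∀ (s : Site P j) (ν : Fin P.d), s ∈ (castSite '' Set.Icc A' B' : Set (Site P j)) → s.shift ν ∈ (castSite '' Set.Icc A B : Set (Site P j)) →
      dist1 (holAt U (walk r (w' s)) * U ⟨s, ν⟩ * (holAt U (walk r (w (s.shift ν))))⁻¹)
        ≤ (((P.d * (max m m' + 1) : ℕ) : ℝ) * KQ + ((2 * (P.d * (max m m' + 1)) + 1 : ℕ) : ℝ) ^ 2 / 4) * δ) := by
  set F : Site P j := castSite f with hF
  set M : ℕ := max m m' + 1 with hM
  have hFQ : F ∈ (castSite '' Set.Icc A B : Set (Site P j)) := ⟨f, ⟨hfA, hfB⟩, rfl⟩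
  set g : GaugeTransf P j G := fun x => holAt U (walk r (w x)) with hg
  have hKδ : 0 ≤ KQ * δ := mul_nonneg hKQ hδ
  have hlenz : ∀ n : Fin P.d → ℤ, (∀ κ, (n κ).natAbs ≤ M) → (stairWord σ' n).length ≤ P.d * M := fun n hn => by
    have h := length_stairRuns_le n M ((List.finRange P.d).map σ') fun a _ => hn a
    rwa [List.length_map, List.length_finRange] at h
  have hwalk : ∀ x : Fin P.d → ℤ, walkEnd F (stairWord σ' (x - f)) = castSite x := fun x => by
    rw [hF, walkEnd_castSite]; congr 1; funext κ; rw [netDisp_stairWord, Pi.sub_apply]; ring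
  -- the steps of a stair walk inside `Q` are `Q`-bonds: `U^g` is `K_Q δ`-near `1` on them
  have hsteps : ∀ x : Fin P.d → ℤ, A ≤ x → x ≤ B →
      ∀ st ∈ walk F (stairWord σ' (x - f)), dist1 (GaugeField.gaugeAct g U st.bond) ≤ KQ * δ := by
    intro x hxA hxB st hst
    obtain ⟨h1, h2⟩ := walk_stairWord_mem_box σ' hfA hfB hxA hxB st hst
    rcases st with ⟨⟨x₀, κ₀⟩, fw⟩
    exact hQ x₀ κ₀ h1 h2
  have hnum : ∀ a b c : ℕ, a ≤ P.d * M → b ≤ P.d * M → c ≤ P.d * M →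
      (a : ℝ) * (KQ * δ) + ((((b + 1 + c : ℕ) : ℝ) ^ 2 / 4) * δ)
        ≤ (((P.d * M : ℕ) : ℝ) * KQ + ((2 * (P.d * M) + 1 : ℕ) : ℝ) ^ 2 / 4) * δ := by
    intro a b c ha hb hc
    have h1 : (a : ℝ) ≤ ((P.d * M : ℕ) : ℝ) := by exact_mod_cast ha
    have h2 : (((b + 1 + c : ℕ) : ℝ)) ≤ ((2 * (P.d * M) + 1 : ℕ) : ℝ) := by exact_mod_cast (by omega)
    have h3 : (0 : ℝ) ≤ ((b + 1 + c : ℕ) : ℝ) := Nat.cast_nonneg _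
    calc (a : ℝ) * (KQ * δ) + ((((b + 1 + c : ℕ) : ℝ) ^ 2 / 4) * δ)
        ≤ ((P.d * M : ℕ) : ℝ) * (KQ * δ) + ((((2 * (P.d * M) + 1 : ℕ) : ℝ) ^ 2 / 4) * δ) :=
          add_le_add (mul_le_mul_of_nonneg_right h1 hKδ)
            (mul_le_mul_of_nonneg_right (div_le_div_of_nonneg_right (pow_le_pow_left₀ h3 h2 2) (by norm_num)) hδ)
      _ = _ := by ring
  -- the located Stokes hypothesis of a cross loop from the cross box: parent end `q ∈ [A, B]` with `q_μ = f̃_μ`, bond axis `μ`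
  have hbox : ∀ (n : Fin P.d → ℤ) (q : Fin P.d → ℤ), A ≤ q → q ≤ B → (∀ κ, κ ≠ μ → n κ = q κ - f κ) →
      ∀ lw : List (Letter P.d), (∀ κ b, lw.count (κ, b) ≤ if κ = μ then 1 else (n κ).natAbs) →
        (boxPlaqs (fun ν => f ν - (lw.count (ν, false) : ℕ)) (fun ν => f ν + (lw.count (ν, true) : ℕ) + 2) : Set (Plaq P j)) ⊆ S := by
    intro n q hqA hqB hn lw hlw
    refine (boxPlaqs_mono (fun κ => ?_) (fun κ => ?_)).trans hS
    · have hc := hlw κ false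
      show (if κ = μ then f μ - 1 else min (A κ) (2 * f κ - B κ)) ≤ f κ - ((lw.count (κ, false) : ℕ) : ℤ)
      by_cases hκ : κ = μ
      · rw [if_pos hκ] at hc ⊢; subst hκ
        have : ((lw.count (κ, false) : ℕ) : ℤ) ≤ 1 := by exact_mod_cast hc
        linarith
      · rw [if_neg hκ] at hc ⊢
        have h1 : ((lw.count (κ, false) : ℕ) : ℤ) ≤ |q κ - f κ| := by
          have : ((lw.count (κ, false) : ℕ) : ℤ) ≤ (((n κ).natAbs : ℕ) : ℤ) := by exact_mod_cast hc
          rwa [Int.natCast_natAbs, hn κ hκ] at this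
        have := hqA κ; have := hqB κ
        have hmin1 := min_le_left (A κ) (2 * f κ - B κ); have hmin2 := min_le_right (A κ) (2 * f κ - B κ)
        rcases abs_cases (q κ - f κ) with ⟨ha, _⟩ | ⟨ha, _⟩ <;> linarith
    · have hc := hlw κ true
      show f κ + ((lw.count (κ, true) : ℕ) : ℤ) + 2 ≤ (if κ = μ then f μ + 3 else max (B κ) (2 * f κ - A κ) + 2)
      by_cases hκ : κ = μ
      · rw [if_pos hκ] at hc ⊢; subst hκ
        have : ((lw.count (κ, true) : ℕ) : ℤ) ≤ 1 := by exact_mod_cast hc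
        linarith
      · rw [if_neg hκ] at hc ⊢
        have h1 : ((lw.count (κ, true) : ℕ) : ℤ) ≤ |q κ - f κ| := by
          have : ((lw.count (κ, true) : ℕ) : ℤ) ≤ (((n κ).natAbs : ℕ) : ℤ) := by exact_mod_cast hc
          rwa [Int.natCast_natAbs, hn κ hκ] at this
        have := hqA κ; have := hqB κ
        have hmax1 := le_max_left (B κ) (2 * f κ - A κ); have hmax2 := le_max_right (B κ) (2 * f κ - A κ)
        rcases abs_cases (q κ - f κ) with ⟨ha, _⟩ | ⟨ha, _⟩ <;> linarith
  refine ⟨fun s ν hs ht => ?_, fun s ν hs ht => ?_⟩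
  · obtain ⟨q, ⟨hqA, hqB⟩, rfl⟩ := hs
    obtain ⟨htA, htB, htcast⟩ := hrep' _ ht
    set t : Fin P.d → ℤ := rep' ((castSite q : Site P j).shift ν) with htdef
    have hcast : (castSite t : Site P j) = castSite (q + e ν) := by rw [htcast, castSite_add_e]
    obtain ⟨hteq, hνμ, hqμ, -⟩ := crossBond_forced hN hsep hfB hfA' hqA hqB htA htB hcast
    subst hνμ
    have hz : walkEnd F (stairWord σ' (q - f)) = castSite q := hwalk q
    have hsw : walkEnd F (stairWord σ' (t - f)) = (castSite q : Site P j).shift ν := by rw [hwalk, hteq, castSite_add_e]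
    have hnz : ∀ κ, ((q - f) κ).natAbs ≤ M := fun κ => by
      have e1 : A κ ≤ q κ := hqA κ; have e2 : q κ ≤ B κ := hqB κ; have e3 : A κ ≤ f κ := hfA κ; have e4 : f κ ≤ B κ := hfB κ
      have e5 : B κ ≤ A κ + m := hm κ
      rw [Pi.sub_apply, hM]; omega
    have hnsw : ∀ κ, ((t - f) κ).natAbs ≤ M := fun κ => by
      have e1 : A' κ ≤ t κ := htA κ; have e2 : t κ ≤ B' κ := htB κ; have e5 : B' κ ≤ A' κ + m' := hm' κ
      have h6 : A' κ - 1 ≤ f κ := by have := hfA' κ; rwa [Pi.sub_apply, Pi.one_apply] at this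
      have h7 : f κ ≤ B' κ + 1 := by have := hfB' κ; rwa [Pi.add_apply, Pi.one_apply] at this
      rw [Pi.sub_apply, hM]; omega
    have hlz := hlenz _ hnz
    have hlsw := hlenz _ hnsw
    have hlen : (stairWord σ' (q - f)).length + 1 + (stairWord σ' (t - f)).length < P.sitesPerDir j := by omega
    have hcnt := count_crossLoop_le σ' σ' (q - f) (t - f) ν (fun κ hκ => by
        rw [hteq, Pi.sub_apply, Pi.sub_apply, Pi.add_apply, e_apply, if_neg hκ, add_zero])
      (Or.inl ⟨by rw [Pi.sub_apply, hqμ, sub_self], by rw [hteq, Pi.sub_apply, Pi.add_apply, e_apply, if_pos rfl, hqμ]; ring⟩)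
    have hloc := plaq_countBox_lt_of_plaqSmallOn_boxPlaqs U F f rfl _ hU
      (hbox (q - f) q hqA hqB (fun κ _ => by rw [Pi.sub_apply]) _ hcnt)
    have key := dist1_crossBond_le_of_entry U g F (castSite q) ν (stairWord σ' (q - f)) (stairWord σ' (t - f)) hz hsw hKδ hδ
      (hsteps q hqA hqB) hlen hloc
    have hgt : holAt U (walk r (w' ((castSite q : Site P j).shift ν))) = g F * holAt U (walk F (stairWord σ' (t - f))) := by
      rw [hw' _ ht, walk_append, holAt_append, hQend F hFQ]
    rw [hgt]
    exact key.trans (hnum _ _ _ hlz hlz hlsw)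
  · obtain ⟨hsA, hsB, hscast⟩ := hrep' s hs
    set q' : Fin P.d → ℤ := rep' s with hq'def
    obtain ⟨t, ⟨htA, htB⟩, htcast⟩ := ht
    have hcast : (castSite t : Site P j) = castSite (q' + e ν) := by rw [htcast, ← hscast, castSite_add_e]
    obtain ⟨hteq, hνμ, htμ, -⟩ := crossBond_forced' hN hsep hfA hfB' hsA hsB htA htB hcast
    subst hνμ
    have hsw : walkEnd F (stairWord σ' (q' - f)) = s := by rw [hwalk, hscast]
    have hz : walkEnd F (stairWord σ' (t - f)) = s.shift ν := by rw [hwalk, htcast]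
    have hnsw : ∀ κ, ((q' - f) κ).natAbs ≤ M := fun κ => by
      have e1 : A' κ ≤ q' κ := hsA κ; have e2 : q' κ ≤ B' κ := hsB κ; have e5 : B' κ ≤ A' κ + m' := hm' κ
      have h6 : A' κ - 1 ≤ f κ := by have := hfA' κ; rwa [Pi.sub_apply, Pi.one_apply] at this
      have h7 : f κ ≤ B' κ + 1 := by have := hfB' κ; rwa [Pi.add_apply, Pi.one_apply] at this
      rw [Pi.sub_apply, hM]; omega
    have hnz : ∀ κ, ((t - f) κ).natAbs ≤ M := fun κ => by
      have e1 : A κ ≤ t κ := htA κ; have e2 : t κ ≤ B κ := htB κ; have e3 : A κ ≤ f κ := hfA κ; have e4 : f κ ≤ B κ := hfB κ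
      have e5 : B κ ≤ A κ + m := hm κ
      rw [Pi.sub_apply, hM]; omega
    have hlsw := hlenz _ hnsw
    have hlz := hlenz _ hnz
    have hlen : (stairWord σ' (q' - f)).length + 1 + (stairWord σ' (t - f)).length < P.sitesPerDir j := by omega
    have hcnt := count_crossLoop_le σ' σ' (q' - f) (t - f) ν (fun κ hκ => by
        rw [hteq, Pi.sub_apply, Pi.sub_apply, Pi.add_apply, e_apply, if_neg hκ, add_zero])
      (Or.inr ⟨by
          have h1 : t ν = q' ν + 1 := by rw [hteq, Pi.add_apply, e_apply, if_pos rfl]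
          rw [Pi.sub_apply]; linarith, by rw [Pi.sub_apply, htμ, sub_self]⟩)
    have hloc := plaq_countBox_lt_of_plaqSmallOn_boxPlaqs U F f rfl _ hU
      (hbox (q' - f) t htA htB (fun κ hκ => by
        rw [Pi.sub_apply, hteq, Pi.add_apply, e_apply, if_neg hκ, add_zero]) _ hcnt)
    have key := dist1_crossBond_le_of_entry' U g F s ν (stairWord σ' (q' - f)) (stairWord σ' (t - f)) hsw hz hKδ hδ
      (hsteps t htA htB) hlen hloc
    have hgs : holAt U (walk r (w' s)) = g F * holAt U (walk F (stairWord σ' (q' - f))) := by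
      rw [hw' s hs, walk_append, holAt_append, hQend F hFQ]
    rw [hgs]
    exact key.trans (hnum _ _ _ hlz hlsw hlz)

/-- ★★★ **THE GLUING STEP OF THE TREE OF BOXES.**  A rooted word system `(r, X, w)` (words end at their sites; (INV) on the bonds of `X` with constant `K`) containing the parent box
`Q = castSite '' [A, B] ⊆ X` (with its own constant `K_Q` on `Q`'s bonds — for a box glued earlier this is `boxWords_bondBound`'s `K_box`, NOT the running `K`); a child box
`Q′ = castSite '' [A′, B′]` touching `X` only through `Q`, separated from `Q` in the gluing axis `μ`; entry `f̃ ∈ [A, B] ∩ [A′ − 1, B′ + 1]`; the glued words `W = w` on `X`,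
`W x = w(castSite f̃) ++ stairWord σ′ (rep′ x − f̃)` on `Q′` with `μ` FIRST in `σ′`.  If §1's sharp in-child box and §2's cross box of plaquettes lie in `S` (`U` with `δ`-small
plaquettes on `S`), then: (i) every glued word ends at its site; (ii) `|W x| ≤ |w(castSite f̃)| + d·(m′+1)` on `Q′`; (iii) (INV) on `Q′`'s own bonds with `K_box(m′) =
(2(d(m′+1)+1)+1)²∕4` (the constant `Q′` hands to ITS children); (iv) (INV) on all bonds of `X ∪ Q′` with `max K (max K_box(m′) K_cross)`, `K_cross = d·M̄·K_Q + (2dM̄+1)²∕4` —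
so along a tree of boxes of bounded size the constant is the same at every depth.  Output = input shape: the lemma iterates («box ∪ (tree of boxes) glued along a face», lane
word l.37564), and (iv) is the letter `hab` of `T4WordSystemGaugeBound.exists_gauge_one_on_nearFlat_of_bondBound`. [cite: Balaban1989LargeFieldI, p.194 (sentence after (1.77)); Balaban1985Averaging, (8)-(9) p.19 and (19)-(20) p.21; Balaban1987RG1, (0.3) p.252] -/
theorem treeGlue_union_bondBound (U : GaugeField P j G) {S : Set (Plaq P j)} {δ : ℝ} (hδ : 0 ≤ δ) (hU : PlaqSmallOn S δ U)
    (r : Site P j) (X : Set (Site P j)) (w : Site P j → List (Letter P.d))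
    (hXend : ∀ x ∈ X, walkEnd r (w x) = x) {K : ℝ}
    (hXK : ∀ (s : Site P j) (ν : Fin P.d), s ∈ X → s.shift ν ∈ X →
      dist1 (holAt U (walk r (w s)) * U ⟨s, ν⟩ * (holAt U (walk r (w (s.shift ν))))⁻¹) ≤ K * δ)
    {A B : Fin P.d → ℤ} (hQX : (castSite '' Set.Icc A B : Set (Site P j)) ⊆ X) {m : ℕ} (hm : ∀ κ, B κ ≤ A κ + m)
    {KQ : ℝ} (hKQ : 0 ≤ KQ)
    (hQ : ∀ (s : Site P j) (ν : Fin P.d), s ∈ (castSite '' Set.Icc A B : Set (Site P j)) → s.shift ν ∈ (castSite '' Set.Icc A B : Set (Site P j)) →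
      dist1 (holAt U (walk r (w s)) * U ⟨s, ν⟩ * (holAt U (walk r (w (s.shift ν))))⁻¹) ≤ KQ * δ)
    {A' B' : Fin P.d → ℤ} {m' : ℕ} (hm' : ∀ κ, B' κ ≤ A' κ + m') (rep' : Site P j → Fin P.d → ℤ)
    (hrep' : ∀ x ∈ (castSite '' Set.Icc A' B' : Set (Site P j)), A' ≤ rep' x ∧ rep' x ≤ B' ∧ (castSite (rep' x) : Site P j) = x)
    (hN' : ∀ κ, B' κ - A' κ + 3 < (P.sitesPerDir j : ℤ)) (hN : ∀ κ, max (B κ) (B' κ) + 1 - min (A κ) (A' κ) < (P.sitesPerDir j : ℤ))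
    (μ : Fin P.d) (hsep : B μ < A' μ ∨ B' μ < A μ) {f : Fin P.d → ℤ} (hfA : A ≤ f) (hfB : f ≤ B) (hfA' : A' - 1 ≤ f) (hfB' : f ≤ B' + 1)
    (σ' : Equiv.Perm (Fin P.d)) (hσ' : ∃ rest, (List.finRange P.d).map σ' = μ :: rest)
    (hMN : 2 * (P.d * (max m m' + 1) + 1) + 1 < P.sitesPerDir j)
    (htouch : ∀ (s : Site P j) (ν : Fin P.d), s ∈ X → s.shift ν ∈ (castSite '' Set.Icc A' B' : Set (Site P j)) → s ∈ (castSite '' Set.Icc A B : Set (Site P j)))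
    (htouch' : ∀ (s : Site P j) (ν : Fin P.d), s ∈ (castSite '' Set.Icc A' B' : Set (Site P j)) → s.shift ν ∈ X → s.shift ν ∈ (castSite '' Set.Icc A B : Set (Site P j)))
    (W : Site P j → List (Letter P.d)) (hWX : ∀ x ∈ X, W x = w x)
    (hWQ' : ∀ x ∈ (castSite '' Set.Icc A' B' : Set (Site P j)), W x = w (castSite f) ++ stairWord σ' (rep' x - f))
    (hSin : (boxPlaqs (fun κ => (if κ = μ then A' κ else min (A' κ) (2 * f κ - B' κ)) - 1)
              (fun κ => (if κ = μ then B' κ else max (B' κ) (2 * f κ - A' κ)) + 3) : Set (Plaq P j)) ⊆ S)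
    (hScross : (boxPlaqs (fun κ => if κ = μ then f μ - 1 else min (A κ) (2 * f κ - B κ))
              (fun κ => if κ = μ then f μ + 3 else max (B κ) (2 * f κ - A κ) + 2) : Set (Plaq P j)) ⊆ S) :
    (∀ x ∈ X ∪ (castSite '' Set.Icc A' B' : Set (Site P j)), walkEnd r (W x) = x) ∧
    (∀ x ∈ (castSite '' Set.Icc A' B' : Set (Site P j)), (W x).length ≤ (w (castSite f)).length + P.d * (m' + 1)) ∧
    (∀ (s : Site P j) (ν : Fin P.d), s ∈ (castSite '' Set.Icc A' B' : Set (Site P j)) → s.shift ν ∈ (castSite '' Set.Icc A' B' : Set (Site P j)) →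
      dist1 (holAt U (walk r (W s)) * U ⟨s, ν⟩ * (holAt U (walk r (W (s.shift ν))))⁻¹) ≤ (((2 * (P.d * (m' + 1) + 1) + 1 : ℕ) : ℝ) ^ 2 / 4) * δ) ∧
    (∀ (s : Site P j) (ν : Fin P.d), s ∈ X ∪ (castSite '' Set.Icc A' B' : Set (Site P j)) → s.shift ν ∈ X ∪ (castSite '' Set.Icc A' B' : Set (Site P j)) →
      dist1 (holAt U (walk r (W s)) * U ⟨s, ν⟩ * (holAt U (walk r (W (s.shift ν))))⁻¹)
        ≤ max K (max (((2 * (P.d * (m' + 1) + 1) + 1 : ℕ) : ℝ) ^ 2 / 4)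
            ((((P.d * (max m m' + 1) : ℕ) : ℝ) * KQ + ((2 * (P.d * (max m m' + 1)) + 1 : ℕ) : ℝ) ^ 2 / 4))) * δ) := by
  have hFQ : (castSite f : Site P j) ∈ (castSite '' Set.Icc A B : Set (Site P j)) := ⟨f, ⟨hfA, hfB⟩, rfl⟩
  have hρ : walkEnd r (w (castSite f)) = castSite f := hXend _ (hQX hFQ)
  have hmN' : 2 * (P.d * (m' + 1) + 1) + 1 < P.sitesPerDir j := by
    have : P.d * (m' + 1) ≤ P.d * (max m m' + 1) := Nat.mul_le_mul_left _ (by omega)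
    omega
  have hMN' : 2 * (P.d * (max m m' + 1)) + 1 < P.sitesPerDir j := by omega
  obtain ⟨hend', hlen', hbd'⟩ := boxWords_bondBound U hδ hU σ' hσ' hfA' hfB' hN' hm' hmN' rep' hrep' r (w (castSite f)) hρ W hWQ' hSin
  obtain ⟨hc1, hc2⟩ := treeGlue_crossBond_bondBound U hδ hU r w hm (fun x hx => hXend x (hQX hx)) hKQ hQ hm' rep' hrep' hN μ hsep
    hfA hfB hfA' hfB' σ' W hWQ' hMN' hScross
  refine ⟨?_, hlen', hbd', ?_⟩
  · rintro x (hx | hx)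
    · rw [hWX x hx]; exact hXend x hx
    · exact hend' x hx
  rintro s ν (hs | hs) (ht | ht)
  · rw [hWX s hs, hWX _ ht]
    exact (hXK s ν hs ht).trans (mul_le_mul_of_nonneg_right (le_max_left _ _) hδ)
  · rw [hWX s hs]
    exact (hc1 s ν (htouch s ν hs ht) ht).trans (mul_le_mul_of_nonneg_right ((le_max_right _ _).trans (le_max_right _ _)) hδ)
  · rw [hWX _ ht]
    exact (hc2 s ν hs (htouch' s ν hs ht)).trans (mul_le_mul_of_nonneg_right ((le_max_right _ _).trans (le_max_right _ _)) hδ)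
  · exact (hbd' s ν hs ht).trans (mul_le_mul_of_nonneg_right ((le_max_left _ _).trans (le_max_right _ _)) hδ)

end Glue

/-! ## §4 The consumers: the normaliser from (INV), and the edition at the objects of Proposition 1 in the shape of the letter `hgauge` -/

section Consumer

variable {G : Type*} [GaugeGroup G]

/-- ★★ **THE NORMALISER FROM (INV)** (any `GaugeGroup`, level `j`): a rooted word system `(r, X, w)` whose bonds satisfy (INV) with constant `C` for the configuration `W`; a site set
`B` whose words have length `≤ ℓ` and run through bonds with both ends in `B`, on which `W` is `ε₁`-near `1`.  Then the glued gauge `u = 1` on `B`, `u = 𝒰_W(walk r (w ·))` off `B`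
has `dist1 (W^u b) ≤ C + ℓ·ε₁ + ε₁` on every bond with both ends in `X` (`T4WordSystemGaugeBound.exists_gauge_one_on_nearFlat_of_bondBound` with its letters `haB`, `hab` produced).
[cite: Balaban1989LargeFieldI, p.194 (sentence after (1.77)); Balaban1985Averaging, (8)-(9) p.19 and (19)-(20) p.21] -/
theorem exists_gauge_one_on_nearFlat_of_bondBoundSystem (W : GaugeField P j G) (B X : Set (Site P j))
    (r : Site P j) (w : Site P j → List (Letter P.d)) {ℓ : ℕ} (hℓ : ∀ x ∈ B, (w x).length ≤ ℓ)
    (hin : ∀ x ∈ B, ∀ st ∈ walk r (w x), st.bond.src ∈ B ∧ st.bond.tgt ∈ B)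
    {ε₁ C : ℝ} (hε₁ : 0 ≤ ε₁) (hC : 0 ≤ C)
    (h1 : ∀ b : PBond P j, b.src ∈ B → b.tgt ∈ B → dist1 (W b) ≤ ε₁)
    (hab : ∀ (s : Site P j) (ν : Fin P.d), s ∈ X → s.shift ν ∈ X →
      dist1 (holAt W (walk r (w s)) * W ⟨s, ν⟩ * (holAt W (walk r (w (s.shift ν))))⁻¹) ≤ C) :
    ∃ u : GaugeTransf P j G, (∀ s ∈ B, u s = 1) ∧ (∀ s, s ∉ B → u s = holAt W (walk r (w s))) ∧
      ∀ b : PBond P j, b.src ∈ X → b.tgt ∈ X → dist1 (GaugeField.gaugeAct u W b) ≤ C + ℓ * ε₁ + ε₁ := by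
  have hη : (0 : ℝ) ≤ ℓ * ε₁ := by positivity
  have haB : ∀ x ∈ B, dist1 (holAt W (walk r (w x))) ≤ ℓ * ε₁ := fun x hx => by
    have h := dist1_holAt_le_length_mul W hε₁ (walk r (w x)) fun st hst => h1 st.bond (hin x hx st hst).1 (hin x hx st hst).2
    rw [length_walk'] at h
    exact h.trans (mul_le_mul_of_nonneg_right (by exact_mod_cast hℓ x hx) hε₁)
  exact exists_gauge_one_on_nearFlat_of_bondBound W B X (fun x => holAt W (walk r (w x))) hC hη hε₁ haB h1 fun s ν hs ht _ => hab s ν hs ht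

variable {k : ℕ} {lo hi : Fin P.d → ℤ}

/-- A point of `[lo, hi]` is a point of the big box `[lo − 1, hi + 1]`. [cite: Balaban1989LargeFieldI, p.193 (print's enlarged cube `□̃`)] -/
theorem mem_bigBox_of_mem_box' {x : Fin P.d → ℤ} (hx : lo ≤ x) (hx' : x ≤ hi) :
    (castSite x : Site P k) ∈ (castSite '' Set.Icc (lo - 1) (hi + 1) : Set (Site P k)) :=
  ⟨x, ⟨fun κ => by have := hx κ; rw [Pi.sub_apply, Pi.one_apply]; linarith,
    fun κ => by have := hx' κ; rw [Pi.add_apply, Pi.one_apply]; linarith⟩, rfl⟩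

/-- ★★★ **THE TREE-OF-BOXES NORMALISER OF THE EXTENDED DATUM, IN THE SHAPE OF THE LETTER `hgauge`** (`T4WordSystemGaugeBound.exists_gauge_normalising_extend_of_words_hub_le` with the
hub letter `hcount` REPLACED by (INV)): at the objects of [15] Proposition 1 — the small-field box `Λ^{(k)} = castSite '' [lo, hi]` inside `Z^{(k)}` with its big box, `V` with
`ε`-small plaquettes on `Z ∩ Λᶜ`, the extended datum `Ṽ_k = extend Λ^{(k)} (shellGauge V lo hi) V` (dag-n12-w6 §7) — and a rooted word system `(r, X, w)` whose words of the
big-box sites have length `≤ ℓ` and stay in the big box (`hin`), IF every configuration `U′` with `(12d(n+2)² + 1)ε`-small plaquettes on `Z^{(k)}` satisfies (INV) on the bonds of `X`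
with constant `K` (the OUTPUT of `boxWords_bondBound` ∕ `treeGlue_union_bondBound` iterated along a tree of boxes whose located plaquette boxes lie in `Z^{(k)}`), THEN
`∃ u, u = 1 on Λ^{(k)}, u(castSite (lo − 1)) = 1, dist1 ((Ṽ_k)^u b) ≤ ρ` on every `b ∈ 𝒞` with both ends in `X`, for any
`ρ ≥ K·(12d(n+2)² + 1)ε + (ℓ + 1)·3d(n+2)²ε`. [cite: Balaban1989LargeFieldI, p.193, p.194 (sentence after (1.77))] -/
theorem exists_gauge_normalising_extend_of_bondBoundSystem_le (hd : 3 ≤ P.d) (hlohi : lo ≤ hi) {n : ℕ}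
    (hn : ∀ κ, hi κ ≤ lo κ + n) (hN : ∀ κ, hi κ - lo κ + 3 < (P.sitesPerDir k : ℤ)) {Z Λ : Set (Site P 0)}
    (hbox : pts k Λ = (castSite '' Set.Icc lo hi : Set (Site P k)))
    (hZ : (boxPlaqs (lo - 1) (hi + 1) : Set (Plaq P k)) ⊆ plaqsInside (pts k Z))
    {ε : ℝ} (hε : 0 < ε) {V : GaugeField P k G} (hreg : PlaqSmallOn (plaqsInside (pts k (Z ∩ Λᶜ))) ε V)
    (X : Set (Site P k)) (r : Site P k) (w : Site P k → List (Letter P.d))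
    {ℓ : ℕ} (hℓ : ∀ x ∈ (castSite '' Set.Icc (lo - 1) (hi + 1) : Set (Site P k)), (w x).length ≤ ℓ)
    (hin : ∀ x ∈ (castSite '' Set.Icc (lo - 1) (hi + 1) : Set (Site P k)), ∀ st ∈ walk r (w x),
      st.bond.src ∈ (castSite '' Set.Icc (lo - 1) (hi + 1) : Set (Site P k)) ∧
        st.bond.tgt ∈ (castSite '' Set.Icc (lo - 1) (hi + 1) : Set (Site P k)))
    {K : ℝ} (hK : 0 ≤ K)
    (hinv : ∀ U' : GaugeField P k G, PlaqSmallOn (plaqsInside (pts k Z)) ((12 * P.d * (n + 2) ^ 2 + 1) * ε) U' →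
      ∀ (s : Site P k) (ν : Fin P.d), s ∈ X → s.shift ν ∈ X →
        dist1 (holAt U' (walk r (w s)) * U' ⟨s, ν⟩ * (holAt U' (walk r (w (s.shift ν))))⁻¹) ≤ K * ((12 * P.d * (n + 2) ^ 2 + 1) * ε))
    (𝒞 : Set (PBond P k)) (h𝒞 : ∀ b ∈ 𝒞, b.src ∈ X ∧ b.tgt ∈ X) {ρ : ℝ}
    (hρ : K * ((12 * P.d * (n + 2) ^ 2 + 1) * ε) + (ℓ + 1) * (3 * P.d * (n + 2) ^ 2 * ε) ≤ ρ) :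
    ∃ u : GaugeTransf P k G, (∀ s ∈ pts k Λ, u s = 1) ∧ u (castSite (lo - 1)) = 1 ∧
      ∀ b ∈ 𝒞, dist1 (GaugeField.gaugeAct u (extend (pts k Λ) (shellGauge V lo hi) V) b) ≤ ρ := by
  set big : Set (Site P k) := castSite '' Set.Icc (lo - 1) (hi + 1) with hbig
  set g : GaugeTransf P k G := shellGauge V lo hi with hg
  set W : GaugeField P k G := extend (pts k Λ) g V with hWdef
  set W' : GaugeField P k G := GaugeField.gaugeAct (cutoff (pts k Λ) g) W with hW'def
  obtain ⟨hplaq, -⟩ := dist1_plaqHol_extend_shellGauge_le (G := G) hd hlohi hn hN hbox hZ hε hreg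
  have hW : PlaqSmallOn (plaqsInside (pts k Z)) ((12 * P.d * (n + 2) ^ 2 + 1) * ε) W := fun p hp =>
    calc dist1 (GaugeField.plaqHol W p) ≤ 12 * P.d * (n + 2) ^ 2 * ε := hplaq p hp
      _ < (12 * P.d * (n + 2) ^ 2 + 1) * ε := by nlinarith
  have hW' : PlaqSmallOn (plaqsInside (pts k Z)) ((12 * P.d * (n + 2) ^ 2 + 1) * ε) W' :=
    (plaqSmallOn_gaugeAct_iff _ _ _ W).2 hW
  have h1 : ∀ b : PBond P k, b.src ∈ big → b.tgt ∈ big → dist1 (W' b) ≤ 3 * P.d * (n + 2) ^ 2 * ε := by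
    rintro b ⟨x, ⟨hx, hx'⟩, hsrc⟩ ⟨y, ⟨hy, hy'⟩, htgt⟩
    refine dist1_primed_shellGauge_le_bigBox hd hlohi hn hN hbox hZ hε.le hreg b ⟨x, hx, ?_, hsrc.symm⟩
    have htgt' : (castSite y : Site P k) = castSite (x + e b.dir) := by
      rw [htgt, castSite_add_e, hsrc]; rfl
    have e1 : ∀ κ, lo κ - 1 ≤ y κ := fun κ => by have h := hy κ; rwa [Pi.sub_apply, Pi.one_apply] at h
    have e2 : ∀ κ, y κ ≤ hi κ + 2 := fun κ => by have h : y κ ≤ (hi + 1) κ := hy' κ; rw [Pi.add_apply, Pi.one_apply] at h; linarith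
    have e01 : ∀ κ, (0 : ℤ) ≤ e b.dir κ ∧ e b.dir κ ≤ 1 := fun κ => by rw [e_apply]; split_ifs <;> simp
    have e3 : ∀ κ, lo κ - 1 ≤ (x + e b.dir) κ := fun κ => by
      have h : (lo - 1) κ ≤ x κ := hx κ; rw [Pi.sub_apply, Pi.one_apply] at h; rw [Pi.add_apply]; linarith [(e01 κ).1]
    have e4 : ∀ κ, (x + e b.dir) κ ≤ hi κ + 2 := fun κ => by
      have h : x κ ≤ (hi + 1) κ := hx' κ; rw [Pi.add_apply, Pi.one_apply] at h; rw [Pi.add_apply]; linarith [(e01 κ).2]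
    have heq : y = x + e b.dir := B15Extension193.castSite_inj_big hN e1 e2 e3 e4 htgt'
    rw [← heq]; exact hy'
  have hε₁ : (0 : ℝ) ≤ 3 * P.d * (n + 2) ^ 2 * ε := by positivity
  have hC : (0 : ℝ) ≤ K * ((12 * P.d * (n + 2) ^ 2 + 1) * ε) := by positivity
  obtain ⟨u', hu'1, -, hu'⟩ := exists_gauge_one_on_nearFlat_of_bondBoundSystem W' big X r w hℓ hin hε₁ hC h1 (hinv W' hW')
  have hc₀big : (castSite (lo - 1) : Site P k) ∈ big :=
    ⟨lo - 1, ⟨le_rfl, fun κ => by have := hlohi κ; rw [Pi.sub_apply, Pi.add_apply, Pi.one_apply]; linarith⟩, rfl⟩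
  have hc₀Λ : (castSite (lo - 1) : Site P k) ∉ pts k Λ := by
    rw [hbox]
    rintro ⟨x, ⟨hx, hx'⟩, hxe⟩
    have heq : x = lo - 1 := B15Extension193.castSite_inj_big hN
      (fun κ => by have := hx κ; linarith) (fun κ => by have := hx' κ; linarith)
      (fun κ => by rw [Pi.sub_apply, Pi.one_apply]) (fun κ => by have := hlohi κ; rw [Pi.sub_apply, Pi.one_apply]; linarith) hxe
    have := hx ⟨0, by omega⟩
    rw [heq, Pi.sub_apply, Pi.one_apply] at this; linarith
  refine ⟨fun s => u' s * cutoff (pts k Λ) g s, fun s hs => ?_, ?_, fun b hb => ?_⟩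
  · have hs' : s ∈ big := by
      have hs2 := hs
      rw [hbox] at hs2; obtain ⟨x, ⟨hx, hx'⟩, rfl⟩ := hs2; exact mem_bigBox_of_mem_box' hx hx'
    show u' s * cutoff (pts k Λ) g s = 1
    rw [hu'1 s hs', cutoff_of_mem g hs, one_mul]
  · show u' (castSite (lo - 1)) * cutoff (pts k Λ) g (castSite (lo - 1)) = 1
    rw [hu'1 _ hc₀big, cutoff_of_not_mem g hc₀Λ, one_mul, hg, shellGauge_corner_eq_one hlohi hN V]
  · rw [gaugeAct_mul_eq]
    refine ((hu' b (h𝒞 b hb).1 (h𝒞 b hb).2).trans ?_).trans hρ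
    nlinarith

end Consumer

end Literature.MathematicalPhysics.QuantumFieldTheory.Balaban1983to89.T4StairWordSystemCubeTreeGlue

end
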